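import Summits.AnomalousDissipation.AnomalousDissipation.Theses.MomentParity
import Summits.AnomalousDissipation.AnomalousDissipation.Theorems.MomentParityResolvedDissipationOfLerayHopfEnergyEquality

/-!
# Line `lh-energy-equality-bracket` for crux `MomentParity.ResolvedDissipation` (stmt-AnomalousDissipation-14284)
# — skeleton v4 (lead c3, 2026-08-17): CLOSED MODULO ONE CONJECTURE-GRADE STUB

Crux-strategist line (seat `planner-cstrat-stmt-AnomalousDissipation-14284-p1-0`), driven by lead c3
(`prover-line-stmt-AnomalousDissipation-14284-c3-0`). Read `Lines/lh-energy-equality-bracket.md` and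
`STRATEGY-CENSUS.md` first.

## State

All five PROVABLE stubs of v2 are landed tree theorems (route MomentParity, `--supports` stmt-14284):
* S1 `stub_leakingSequence` — `Theorems/MomentParityResolvedDissipationStubLeakingSequence.lean` (p137468);
* S2a `stub_levelWorkMean` — `Theorems/MomentParityResolvedDissipationStubLevelWorkMean.lean` (p137569);
* S2 `stub_limitLawDefect` — `Theorems/MomentParityResolvedDissipationStubLimitLawDefect.lean` (p137521);
* S3 `stub_supportPointDefect` — `Theorems/MomentParityResolvedDissipationStubSupportPointDefect.lean` (p137808);
* S4 `stub_realisedStrictInequality` — `Theorems/MomentParityResolvedDissipationStubRealisedStrictInequality.lean` (p137581);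
and their composition, the UPPER BRACKET `LHEE ⟹ ResolvedDissipation`, is the tree theorem
`MomentParityResolvedDissipation.LhBracket.resolvedDissipation_of_lerayHopfEnergyEquality`
(`Theorems/MomentParityResolvedDissipationOfLerayHopfEnergyEquality.lean`, p137959; per force and viscosity:
`resolvedAt_of_lerayHopfEnergyEquality`). The lower bracket is the disprover's
`¬ResolvedDissipation ⟺ kill shape ⟹ statistically persistent blow-up` (`Negative/KillShape`, `WhyItResists.md`).

The ONE remaining stub, S5 `stub_lerayHopfEnergyEquality` (LHEE — energy equality of global Leray–Hopf weak
solutions of forced NS on `T³` between positive times), is CONJECTURE-GRADE (Leray 1934 §34, Lions 1960, Shinbrot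
1974; open for `d = 3`; it HOLDS on the Lions class `L⁴L⁴`: tree theorem
`MomentParityResolvedDissipation.LhBracket.lerayHopfEnergyEquality_of_lionsClass`). It is not to be ground by a
lead; the line ends `promote-stub` on it (the planner files LHEE as a `@[conjecture]` item / conditional bridge).

## Disproof.lean honoured
`_false_without_nu_pos`: `0 < ν` enters S1 (energy row), S4 (realisation) and LHEE. `_false_without_stationarity`:
the all-degree rows enter S1 and the level laws. `_false_without_level`: the carrier clause makes the rows
Liouville. §5 `not_resolvedDissipation_iff_killShape` is (per `(f, ν, R)`) the first line of the landed composition.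
No `-- Targets`; no landed Negative lemma concerns S5.
-/

noncomputable section

-- `Summit.<Summit>.<Problem>`: single-conjunct summit, the duplicate namespace segment is mandated.
set_option linter.dupNamespace false

namespace Summit.AnomalousDissipation.AnomalousDissipation.Cruxes.ResolvedDissipation.LhEnergyEqualityBracket

open MeasureTheory Filter Topology Set Function Metric UnitAddTorus
open scoped ENNReal InnerProductSpace RealInnerProductSpace BigOperators
open Literature.Analysis.FunctionSpaces Literature.Analysis.FunctionSpaces.Torus
open Literature.Analysis.FluidPDE Literature.Analysis.FluidPDE.Torus
open Summit.AnomalousDissipation.AnomalousDissipation.Theses.MomentParity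
open Summit.AnomalousDissipation.AnomalousDissipation.Theorems

/-! ## S5 — THE CONJECTURE-GRADE STUB: energy equality of Leray–Hopf weak solutions (size XL, open since 1960) -/

/-- **S5 · `stub_lerayHopfEnergyEquality` (LHEE) — every global Leray–Hopf weak solution of forced NS on T³
conserves energy exactly between positive times.** For `ν > 0`, a smooth divergence-free mean-zero steady force `f`,
and every global Leray–Hopf solution `u` (tree's strict sense `Torus.IsGlobalLerayHopf ν (fun _ => f) u₀ u`):
`½‖u(t₁)‖² + ν∫_{t₀}^{t₁}‖∇u‖² = ½‖u(t₀)‖² + ∫_{t₀}^{t₁} ∫⟪f, u(t)⟫ dt` for all `0 < t₀ ≤ t₁`.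
CONJECTURE-GRADE: the energy equality of Leray–Hopf solutions is OPEN (d = 3); known under `u ∈ L⁴L⁴`
(Lions 1960 / Shinbrot 1974 — in tree: `lerayHopfEnergyEquality_of_lionsClass`, `lions_energy_equality_Ioc`),
`L³B^{1/3}_{3,c₀}` (arXiv:0704.0759), weak-in-time Onsager classes (doi:10.1088/1361-6544/ab60d3), Berselli–Chiodaroli
criteria (doi:10.1016/j.na.2019.111704). Implied by global regularity of NS(ν,f) for `V`-data; NOT known to be implied by
anything weaker. WHY IT MIGHT FAIL: a Leray–Hopf solution with a Duchon–Robert defect at fixed `ν > 0` may exist; then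
this stub is false while the crux may still be true (the bracket is not tight). A lead must NOT grind this stub.
[cite: Leray1934 §34; Lions1960; Shinbrot1974; arXiv:0704.0759; doi:10.1016/j.na.2019.111704; doi:10.1088/1361-6544/ab60d3] -/
theorem stub_lerayHopfEnergyEquality :
    ∀ (ν : ℝ), 0 < ν → ∀ (f : UnitAddTorus (Fin 3) → EuclideanSpace ℝ (Fin 3)),
      Torus.IsSmooth f → Torus.IsDivFree f → Torus.HasZeroMean f →
    ∀ (u₀ : UnitAddTorus (Fin 3) → EuclideanSpace ℝ (Fin 3))
      (u : ℝ → UnitAddTorus (Fin 3) → EuclideanSpace ℝ (Fin 3)),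
      Torus.IsGlobalLerayHopf ν (fun _ => f) u₀ u →
    ∀ (t₀ t₁ : ℝ), 0 < t₀ → t₀ ≤ t₁ →
      Torus.kineticEnergy (u t₁) + ν * (∫⁻ τ in Ioo t₀ t₁, Torus.eGradNormSq (u τ)).toReal =
        Torus.kineticEnergy (u t₀) + ∫ τ in t₀..t₁, ∫ x, ⟪f x, u τ x⟫_ℝ := by
  sorry

/-! ## The composition (kernel-checked; no `sorry` of its own) -/

/-- **`ResolvedDissipation` from LHEE** — the landed upper bracket
`MomentParityResolvedDissipation.LhBracket.resolvedDissipation_of_lerayHopfEnergyEquality` (S1, S2a, S2, S3, S4 and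
the Vishik–Fursikov layer of stmt-11466 inside) applied to the one remaining stub S5. -/
theorem ResolvedDissipation_of : ResolvedDissipation :=
  MomentParityResolvedDissipation.LhBracket.resolvedDissipation_of_lerayHopfEnergyEquality
    stub_lerayHopfEnergyEquality

end Summit.AnomalousDissipation.AnomalousDissipation.Cruxes.ResolvedDissipation.LhEnergyEqualityBracket

end
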